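import Literature.AlgebraicGeometry.AbelianSchemes.LevelStructureTwistAlongIsogeny
import Literature.AlgebraicGeometry.AbelianSchemes.FibreHomPointsOfFibrePoints
import HarnessLib

/-!
# The `level` and `symplectic` fields of the Hecke isogeny quotient `A′/K` in the construction's currency
# ([Deligne1971TravauxShimura] 4.11–4.12; [MumfordFogartyKirwan1994] Ch. 7 §1 Def. 7.1, §3; [Lan2013] §1.3.6)

[MumfordFogartyKirwan1994, Ch. 7 §3 (p. 139)] and [Deligne1971TravauxShimura, 4.11–4.12 (pp. 148–149)]: the quotient of the
universal family `(A′, λ′, φ′)` (level `N′ = N·ν`) by the Hecke kernel `K = γ⁻¹Λ/Λ` carries the induced level-`N` structure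
`ψφ = u ∘ φ′^ν` (`u : A′ → A′/K`), which is again symplectic-liftable for the descended polarisation `λ_B`
(`u ≫ λ_B ≫ u^∨ = λ′^ν`).  THIS FILE is the sub-assembly of those two fields for the socket-(B) assembler of the Hecke link, with
every input in the CURRENCY OF THE CONSTRUCTION: the onto / exact-kernel clauses of `u` on GEOMETRIC FIBRE POINTS
(`FibrePoints`, ★ `AbelianSchemeConstSubgroupQuotient(Kernel)`: «`∀ y, ∃ x, x ≫ u = y`», «`x ≫ u = 1 ↔ ∃ c ∈ K₀, x = φ′(c)|s`»
with the MATRIX index set `K₀ = {c | (γ̄·R′)·c = 0}`, `R′ = ḡ⁻¹ = r′ mod N′`), the integer Hecke datum `(γ, γ⋆, ν, N)`, the two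
similitude towers of `ḡ`, and the descent identity (b) in its `.left`/`mulN` spelling:
* `sectionPow_natCast_smul` — `σ^{(m·a)} = (σ^a)^m` on a commutative group scheme (exponent calculus, MFK 7.1);
* `pow_eq_one_of_comp_eq_one_of_kernelIndex` — the kernel clause ⟹ «`x ≫ u = 1 → x^ν = 1`» (the kernel is `ν`-torsion:
  `K₀ = ḡ·N·γ⋆ℤ^{2g}` and `φ′(N·c′)^ν = φ′(c′)^{Nν} = 1`), the input of ★ H3 `exists_σ_eq_pow_comp_of_coprime`;
* `LevelStructure.exists_level_symplectic_of_heckeQuotient` — **`∃ ψφ : B.LevelStructure g N, (∀ i, ψφᵢ = φ′ᵢ^ν ≫ u) ∧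
  ψφ.IsSymplecticLiftable λ_B δ`**: ★ H3 (level) + ★ `IsSymplecticLiftable.of_fibreIsogeny_of_dualIsogeny_twist` (symplectic) +
  ★ `FibreHomPointsOfFibrePoints` (currency bridges) + ★ `comp_comp_dualIsogenyOver_eq_pow_of_left` ((b) bridge).
Theorems only; cell hodgecm-mathlib, seat B-p04 (g17), (O-y) §2 sub-assembly (split of B-p21 (g14) 23:12:54Z).  HC_CM is proved only
modulo the 7 printed citations until rung 0 closes; this file discharges none of them.

## References
* [Deligne1971TravauxShimura] P. Deligne, *Travaux de Shimura* (1971), 4.11–4.12 (pp. 148–149).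
* [MumfordFogartyKirwan1994] *Geometric Invariant Theory*, 3rd ed., Ch. 7 §1 Def. 7.1 (p. 129), §3 (p. 139), App. 7A (p. 235).
* [Lan2013PELCompactifications] K.-W. Lan (2013), §1.3.6 Def. 1.3.6.2 (p. 80), Lemma 1.3.6.6 and Cor. 1.3.6.7 (pp. 81–82).
* [MumfordAV1970] D. Mumford, *Abelian Varieties* (1970), §23 (Thm. 2, p. 231).
-/

noncomputable section

universe u

open CategoryTheory CategoryTheory.Limits AlgebraicGeometry MonoidalCategory Matrix
open scoped MonObj

namespace Literature.AlgebraicGeometry.AbelianSchemes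

namespace AbelianSchemeOver

open Literature.AlgebraicGeometry.Motives
open Literature.AlgebraicGeometry.ModuliOfAbelianVarieties (typeForm)

variable {S : Scheme.{u}} {A B : AbelianSchemeOver S}

/-! ### §1 Exponent calculus: `σ^{(m·a)} = (σ^a)^m` -/

/-- **`σ^{(m·a)} = (σ^a)^m`** for `n`-torsion sections `σₖ` of a commutative group scheme and `a ∈ (ℤ/n)^{2g}`, `m ∈ ℕ`
(exponents are read mod `n`). [cite: MumfordFogartyKirwan1994, Ch. 7 §1 Definition 7.1 (p. 129)] -/
theorem sectionPow_natCast_smul [IsCommMonObj A.X] {g n : ℕ} [NeZero n] {σ : Fin g ⊕ Fin g → A.Sections}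
    (hσ : ∀ k, σ k ^ n = 1) (m : ℕ) (a : Fin g ⊕ Fin g → ZMod n) :
    A.sectionPow σ ((m : ZMod n) • a) = A.sectionPow σ a ^ m := by
  rw [A.sectionPow_eq_prod, A.sectionPow_eq_prod, ← Finset.prod_pow]
  refine Finset.prod_congr rfl fun k _ => ?_
  rw [← pow_mul, Pi.smul_apply, smul_eq_mul, ZMod.val_mul, ZMod.val_natCast, ← pow_eq_pow_mod _ (hσ k),
    pow_eq_pow_mod ((a k).val * m) (hσ k), pow_eq_pow_mod (m % n * (a k).val) (hσ k), Nat.mod_mul_mod, mul_comm]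

/-- `φ(m·a) = φ(a)^m` for a level structure `φ`. [cite: MumfordFogartyKirwan1994, Ch. 7 §1 Definition 7.1 (p. 129)] -/
theorem LevelStructure.section_natCast_smul [IsCommMonObj A.X] {g n : ℕ} [NeZero n] (φ : A.LevelStructure g n) (m : ℕ)
    (a : Fin g ⊕ Fin g → ZMod n) : φ.section_ ((m : ZMod n) • a) = φ.section_ a ^ m :=
  A.sectionPow_natCast_smul φ.pow_σ m a

/-! ### §2 The Hecke kernel is `ν`-torsion -/

/-- **The kernel clause makes the kernel `ν`-torsion**: if `x ≫ u = 1 ↔ ∃ c ∈ {c | (γ̄·ḡ⁻¹)c = 0}, x = φ′(c)|s` (level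
`N′ = N·ν`, integer `γγ⋆ = γ⋆γ = ν`), then `x ≫ u = 1 → x^ν = 1` — because such `c` are `ḡ·(N·γ⋆z)`, so `φ′(c) = φ′(c′)^N`
and `φ′(c′)^{Nν} = 1`. [cite: Deligne1971TravauxShimura, 4.11–4.12 pp. 148–149] [cite: MumfordFogartyKirwan1994, Ch. 7 §3 (p. 139)] -/
theorem pow_eq_one_of_comp_eq_one_of_kernelIndex [IsCommMonObj A.X] {g N ν : ℕ} (hN : N ≠ 0) (hν : ν ≠ 0)
    (φ' : A.LevelStructure g (N * ν)) (u : A.X ⟶ B.X) [IsMonHom u]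
    (γm γs : Matrix (Fin g ⊕ Fin g) (Fin g ⊕ Fin g) ℤ) (hγ : γm * γs = (ν : ℤ) • (1 : Matrix _ _ ℤ))
    (hγ' : γs * γm = (ν : ℤ) • (1 : Matrix _ _ ℤ)) (gT : GL (Fin g ⊕ Fin g) (ZMod (N * ν)))
    {Ω : Type u} [Field Ω] (s : Spec (.of Ω) ⟶ S)
    (hkerF : ∀ x : A.FibrePoints s, x ≫ u = 1 ↔
      ∃ c ∈ {c : Fin g ⊕ Fin g → ZMod (N * ν) |
          (γm.map (Int.castRingHom (ZMod (N * ν))) *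
              ((gT⁻¹ : GL (Fin g ⊕ Fin g) (ZMod (N * ν))) : Matrix _ _ (ZMod (N * ν)))) *ᵥ c = 0},
        x = A.restrict s (φ'.section_ c))
    (x : A.FibrePoints s) (hx : x ≫ u = 1) : x ^ ν = 1 := by
  haveI : NeZero (N * ν) := ⟨Nat.mul_ne_zero hN hν⟩
  obtain ⟨c, hc, rfl⟩ := (hkerF x).1 hx
  obtain ⟨z, hz⟩ := (intCast_mul_inv_mulVec_eq_zero_iff hN hν γm γs hγ hγ' gT c).1 hc
  -- `c = N • c′` with `c′ := ḡ·(γ⋆z mod Nν)`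
  set c' : Fin g ⊕ Fin g → ZMod (N * ν) :=
    (gT : Matrix _ _ (ZMod (N * ν))) *ᵥ fun j => (((γs *ᵥ z) j : ℤ) : ZMod (N * ν)) with hc'
  have hcN : c = ((N : ℕ) : ZMod (N * ν)) • c' := by
    rw [hz, hc', ← Matrix.mulVec_smul]
    congr 1
    funext j
    rw [Pi.smul_apply, smul_eq_mul, Int.cast_mul, Int.cast_natCast]
  rw [hcN, φ'.section_natCast_smul, A.restrict_pow, ← pow_mul]
  change A.restrict s (A.sectionPow φ'.σ c') ^ (N * ν) = 1
  rw [← A.restrict_pow, A.sectionPow_pow_eq_one φ'.pow_σ, A.restrict_one]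

/-! ### §3 The `level` and `symplectic` fields of the quotient -/

/-- **THE `level` AND `symplectic` FIELDS OF THE HECKE ISOGENY QUOTIENT** (sub-assembly for the socket-(B) assembler): for
`u : A′ → B` (the quotient map by the Hecke kernel) with `B` of relative dimension `g`, both commutative, given — in the
construction's currency — (onto) `∀ y, ∃ x, x ≫ u = y` on geometric fibre points, (kernel) `x ≫ u = 1 ↔ ∃ c ∈ K₀, x = φ′(c)|s`
with `K₀ = {c | (γ̄·ḡ⁻¹)·c = 0} ⊆ (ℤ/Nν)^{2g}` (`ḡ⁻¹ = r′ mod N′`), the integer Hecke datum `γγ⋆ = γ⋆γ = ν`, `ᵗγ⋆E_δγ⋆ = νE_δ`,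
`γ ≡ 1 (mod N)`, `(ν, N) = 1`, two compatible `E_δ`-similitude towers with `ΓA (Nν) = ḡ` and `ΓB N = (ḡ mod N)⁻¹` (★
`exists_similitudeTower` at `r′⁻¹`, `r′`), and the descent identity (b) `u.left ≫ λ_B.left ≫ dualIsogeny u D_A D_B =
λ_A.left ≫ (mulN ν).left`: if `φ′` is symplectic-liftable for `λ_A` (type `δ`) then there is a level-`N` structure `ψφ` on `B`
with `ψφᵢ = φ′ᵢ^ν ≫ u` (★ H3), symplectic-liftable for `λ_B` (type `δ`) (★ `of_fibreIsogeny_of_dualIsogeny_twist`).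
[cite: Deligne1971TravauxShimura, 4.11–4.12 pp. 148–149] [cite: MumfordFogartyKirwan1994, Ch. 7 §1 Definition 7.1 (p. 129) and §3 (p. 139)]
[cite: Lan2013PELCompactifications, §1.3.6 Def. 1.3.6.2 (p. 80), Lemma 1.3.6.6 and Cor. 1.3.6.7 (pp. 81–82)] -/
theorem LevelStructure.exists_level_symplectic_of_heckeQuotient [IsCommMonObj A.X] [IsCommMonObj B.X]
    {g N ν : ℕ} (hN : N ≠ 0) (hν : ν ≠ 0) (hcop : Nat.Coprime ν N)
    {φ' : A.LevelStructure g (N * ν)} {DA : A.DualPair} {polA : A.Polarization DA}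
    {DB : B.DualPair} {polB : B.Polarization DB} {δ : Fin g → ℕ}
    (u : A.X ⟶ B.X) [IsMonHom u] (hB : B.IsOfRelDim g)
    (γm γs : Matrix (Fin g ⊕ Fin g) (Fin g ⊕ Fin g) ℤ) (hγ : γm * γs = (ν : ℤ) • (1 : Matrix _ _ ℤ))
    (hγ' : γs * γm = (ν : ℤ) • (1 : Matrix _ _ ℤ)) (hsim : γsᵀ * typeForm δ * γs = (ν : ℤ) • typeForm δ)
    (hQA4 : ∀ k i, (N : ℤ) ∣ (γm - 1) k i)
    (gT : GL (Fin g ⊕ Fin g) (ZMod (N * ν)))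
    (ΓA : ∀ M : ℕ, GL (Fin g ⊕ Fin g) (ZMod M)) (cA : ∀ M : ℕ, (ZMod M)ˣ) (hΓA_level : ΓA (N * ν) = gT)
    (hΓA : ∀ ⦃M : ℕ⦄ (k : ℕ), M ≠ 0 → k ≠ 0 → ∀ i j,
      ZMod.castHom (Dvd.intro_left k rfl) (ZMod M)
          ((ΓA (k * M) : Matrix (Fin g ⊕ Fin g) (Fin g ⊕ Fin g) (ZMod (k * M))) i j) =
        (ΓA M : Matrix (Fin g ⊕ Fin g) (Fin g ⊕ Fin g) (ZMod M)) i j)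
    (hcA : ∀ ⦃M : ℕ⦄ (k : ℕ), M ≠ 0 → k ≠ 0 →
      ZMod.castHom (Dvd.intro_left k rfl) (ZMod M) ((cA (k * M) : ZMod (k * M))) = (cA M : ZMod M))
    (hsimA : ∀ ⦃M : ℕ⦄, M ≠ 0 → ∀ x y : Fin g ⊕ Fin g → ZMod M,
      typeFormMod δ M ((ΓA M : Matrix (Fin g ⊕ Fin g) (Fin g ⊕ Fin g) (ZMod M)) *ᵥ x)
          ((ΓA M : Matrix (Fin g ⊕ Fin g) (Fin g ⊕ Fin g) (ZMod M)) *ᵥ y) =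
        (cA M : ZMod M) * typeFormMod δ M x y)
    (ΓB : ∀ M : ℕ, GL (Fin g ⊕ Fin g) (ZMod M)) (cB : ∀ M : ℕ, (ZMod M)ˣ)
    (hΓB_level : haveI : NeZero N := ⟨hN⟩;
      ΓB N = (Matrix.GeneralLinearGroup.map (ZMod.castHom (⟨ν, rfl⟩ : N ∣ N * ν) (ZMod N)) gT)⁻¹)
    (hΓB : ∀ ⦃M : ℕ⦄ (k : ℕ), M ≠ 0 → k ≠ 0 → ∀ i j,
      ZMod.castHom (Dvd.intro_left k rfl) (ZMod M)
          ((ΓB (k * M) : Matrix (Fin g ⊕ Fin g) (Fin g ⊕ Fin g) (ZMod (k * M))) i j) =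
        (ΓB M : Matrix (Fin g ⊕ Fin g) (Fin g ⊕ Fin g) (ZMod M)) i j)
    (hcB : ∀ ⦃M : ℕ⦄ (k : ℕ), M ≠ 0 → k ≠ 0 →
      ZMod.castHom (Dvd.intro_left k rfl) (ZMod M) ((cB (k * M) : ZMod (k * M))) = (cB M : ZMod M))
    (hsimB : ∀ ⦃M : ℕ⦄, M ≠ 0 → ∀ x y : Fin g ⊕ Fin g → ZMod M,
      typeFormMod δ M ((ΓB M : Matrix (Fin g ⊕ Fin g) (Fin g ⊕ Fin g) (ZMod M)) *ᵥ x)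
          ((ΓB M : Matrix (Fin g ⊕ Fin g) (Fin g ⊕ Fin g) (ZMod M)) *ᵥ y) =
        (cB M : ZMod M) * typeFormMod δ M x y)
    (hsurjF : ∀ ⦃Ω : Type u⦄ [Field Ω] [IsAlgClosed Ω] (s : Spec (.of Ω) ⟶ S) (y : B.FibrePoints s),
      ∃ x : A.FibrePoints s, x ≫ u = y)
    (hkerF : ∀ ⦃Ω : Type u⦄ [Field Ω] [IsAlgClosed Ω] (s : Spec (.of Ω) ⟶ S) (x : A.FibrePoints s), x ≫ u = 1 ↔
      ∃ c ∈ {c : Fin g ⊕ Fin g → ZMod (N * ν) |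
          (γm.map (Int.castRingHom (ZMod (N * ν))) *
              ((gT⁻¹ : GL (Fin g ⊕ Fin g) (ZMod (N * ν))) : Matrix _ _ (ZMod (N * ν)))) *ᵥ c = 0},
        x = A.restrict s (φ'.section_ c))
    (hb : u.left ≫ polB.lam.left ≫ DualPair.dualIsogeny u DA DB = polA.lam.left ≫ (DA.hat.mulN ν).left)
    (h : φ'.IsSymplecticLiftable polA δ) :
    ∃ ψφ : B.LevelStructure g N, (∀ i, ψφ.σ i = (φ'.σ i ^ ν) ≫ u) ∧ ψφ.IsSymplecticLiftable polB δ := by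
  -- the level: ★ H3 (the kernel is `ν`-torsion, `(ν, N) = 1`)
  obtain ⟨ψφ, hψφ⟩ := φ'.exists_σ_eq_pow_comp_of_coprime (Nat.mul_ne_zero hN hν) u hcop hsurjF
    (fun Ω _ _ s x hx => pow_eq_one_of_comp_eq_one_of_kernelIndex hN hν φ' u γm γs hγ hγ' gT s (hkerF s) x hx)
  refine ⟨ψφ, hψφ, ?_⟩
  -- the symplectic field: ★ twist engine, inputs bridged to `Ω`-points of the fibres
  refine LevelStructure.IsSymplecticLiftable.of_fibreIsogeny_of_dualIsogeny_twist hN hν u hψφ hB γm γs hγ hγ' hsim hQA4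
    gT ΓA cA hΓA_level hΓA hcA hsimA ΓB cB hΓB_level hΓB hcB hsimB
    (fun Ω _ _ s => surjective_map_fibreHom_of_forall_fibrePoints s u (hsurjF s))
    (fun Ω _ _ s P => ?_) (comp_comp_dualIsogenyOver_eq_pow_of_left u polA.lam polB.lam ν hb) h
  rw [map_fibreHom_eq_one_iff_of_fibrePoints_range s u _ φ'.section_ (hkerF s) P]
  simp only [Set.mem_setOf_eq]

end AbelianSchemeOver

end Literature.AlgebraicGeometry.AbelianSchemes

end
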